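import Summits.HodgeConjecture.HodgeConjecture.Theorems.MarkmanPartnerTransportPicardThreeK3SquaresNSAbsorption
import Summits.HodgeConjecture.HodgeConjecture.Theorems.MarkmanPartnerTransportPicardThreeK3SquaresRealMultiplicationRanksCorollaries
import Literature.AlgebraicGeometry.HodgeTheory.DominatedByPowersHodgeConjecture

/-!
# Route MarkmanPartnerTransport · crux `PicardThreeK3Squares` (stmt-HodgeConjecture-19652) —
# «NL-ASCENT», real-QUADRATIC multiplication: modulo the displayed ascent families, every real-quadratic
# RM K3 square is governed by the Picard-number-2 ones (crux #5's cell `(ρ(X), d) = (3, 2)`)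

Sequel to `…NSAbsorption` (p710971) and `…NLAscent`. Memo NL-ASCENT r2 §4 (evidence #54 on the item)
proves the lattice lemma that makes the Noether–Lefschetz ascent UNCONDITIONAL for real quadratic
multiplication down to Picard number 2: *every negative definite ternary rational quadratic space
contains a binary subspace which is a scaled trace form of any prescribed real quadratic field*
(criterion: a binary form `B` is a `ℚ(√D)`-trace form iff it admits a self-adjoint `T` with `T² = D`,
iff `⟨1, det B⟩` represents `D`; then choose the complement value `c = −det W · n` with `n` a negative
global norm in the classes represented by the ternary `W = h^⊥` — local count: `W_p` misses at most one
square class, the norm coset contains at least two; density of `E^×` in `∏ E_p^×`; Hasse–Minkowski,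
O'Meara 63:21 / 66:3). Hence a K3 surface `S` with real multiplication by a real quadratic field and
`ρ(S) ≥ 4` is a Noether–Lefschetz point of a family of the same kind with Picard number `ρ(S) − 2`
(`T(S)_ℚ ⊕ N₀` with the `E`-eigenperiod domain of dimension `m − 1`; very general member: same field,
Picard number `ρ(S) − 2`; flat generator class = generator + NS-supported at `S ⊗ S`). This file runs
the induction on the Picard number in steps of `2` with that family DISPLAYED (moduli input (I1′): the
universal family over the real-multiplication component, not constructed in the tree):

* `hodgeConjectureFor_square_of_quadratic_nlAscent` — **for every projective K3 surface `S` whose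
  rational Hodge endomorphisms of `T(S)` are generated by an endomorphism `t` with an IRREDUCIBLE
  QUADRATIC annihilating polynomial (`Quadratic[S]`: `End_Hdg(T(S)_ℚ)` a quadratic field) and
  `ρ(S) ≥ 2`: `HodgeConjectureFor 4 (S ⊗ S)`**, GRANTED Buskin's Thm. 1.1 and markings (the CM branch:
  imaginary quadratic `E`), the displayed ascent families `hAsc` for the non-CM ones with `ρ(S) ≥ 4`
  (residual fibres: squares of K3 surfaces of the same kind with Picard number `ρ(S) − 2`), and `hCell`:
  HC⁴ for the squares of the non-CM quadratic-RM K3 surfaces of Picard number EXACTLY `2` — the K3 form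
  of crux #5's cell `CellHC[3, 2]` (`X = S^{[2]}`, `ρ(X) = 3`, `[E:ℚ] = 2`; Markman transport both ways).
  (`ρ(S) = 3` carries no real multiplication: `19` is prime, `mul_add_ne_of_lt_six_or_prime`.)
* `hodgeConjectureFor_square_of_quadratic_nlAscent_of_three_le` — the same for `ρ(S) ≥ 3`, the range of
  the crux: **modulo (I1′), the entire real-quadratic real-multiplication third of `PicardThreeK3Squares`
  (`ρ(S) ∈ {4, 6, …, 16}`: every case of the crux in which anything is in print — Varesco `ρ = 16`,
  Schlickewei, Elsenhans–Jahnel, the `√2 / √3 / √5` families of van Geemen–Schütt) is downstream of the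
  Picard-number-`2` real-quadratic RM K3 squares.**

No definition, no sorry; the named facts and the displayed families are hypotheses; nothing here proves
the crux, the cell, or any instance of HC. Prover seat hodge-nonav-19652-p1 (gen 18),
`--supports stmt-HodgeConjecture-19652`.

References: van Geemen–Schütt, Forum Math. Sigma 13 (2025) e2, §2.5–2.6, Prop. 3.2, §3.4, §3.9, §6.6;
van Geemen, Michigan Math. J. 56 (2008) Lemma 3.2; O'Meara, *Introduction to Quadratic Forms*, 63:21,
66:3, 66:4; Voisin, *Hodge Theory II*, §5.3.4, §7.3.2, Thm. 4.18; Cattani–Deligne–Kaplan, JAMS 8 (1995)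
Cor. 1.2; Buskin, J. reine angew. Math. 755 (2019) Thm. 1.1; Varesco, Math. Z. 305 (2023) §2 and
Michigan Math. J. 75 (2025); Markman, arXiv:2204.00516 (transport to `K3^{[2]}`-type).
-/

set_option linter.dupNamespace false

noncomputable section

namespace Summit.HodgeConjecture.HodgeConjecture.Theorems.MarkmanPartnerTransport.NLAscent

open CategoryTheory MonoidalCategory CartesianMonoidalCategory AlgebraicGeometry Polynomial
open Literature.AlgebraicGeometry Literature.AlgebraicGeometry.Motives Literature.AlgebraicGeometry.HodgeTheory
open Literature.AlgebraicGeometry.Surfaces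
open Literature.AlgebraicTopology.SingularHomology
open Summit.HodgeConjecture.HodgeConjecture.Theorems
open Summit.HodgeConjecture.HodgeConjecture.Theorems.NikulinTwinTransport
open Summit.HodgeConjecture.HodgeConjecture.Theorems.MarkmanPartnerTransport.RealMultiplicationRanks

variable {S : SchemeOver ℂ}

/-- `Corr[μ, hS ; γ, y] = fst_*(snd^* y ∪ γ)` on `H²(S(ℂ); ℂ)`. Local notation only. -/
local notation3 (prettyPrint := false) "Corr[" μ ", " hS " ; " γ ", " y "]" =>
  complexGysin μ (IsSmoothProjective.tensor_holds hS hS) hS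
    (SemiCartesianMonoidalCategory.fst _ _) (rfl : 2 * 1 + 2 * 2 + 2 * 2 = 2 * 1 + 2 * (2 + 2))
    (cupProduct (rfl : 2 * 1 + 2 * 2 = 2 * 1 + 2 * 2)
      (complexBetti.map (SemiCartesianMonoidalCategory.snd _ _) (2 * 1) y) γ)

/-- `Quadratic[S]`: **`End_Hdg(T(S)_ℚ)` is a QUADRATIC field, with a displayed generator** — a
rational, type-preserving endomorphism `t` of `H²(S(ℂ); ℂ)` killing `N¹`, with image cup-orthogonal to
`N¹`, generating the rational Hodge endomorphisms of `T(S)` and annihilated on `T(S)` by an irreducible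
rational polynomial of degree `2` (real quadratic = real multiplication by `ℚ(√D)`, or imaginary
quadratic = CM). Local notation only (an `∃`-statement, not a definition).
[cite: GeemenSchutt2023, §2.1 and §3.9] -/
local notation3 (prettyPrint := false) "Quadratic[" S "]" =>
  (∃ (t : complexBetti S (2 * 1) →ₗ[ℂ] complexBetti S (2 * 1)) (P : ℚ[X]),
    (∀ y, IsRationalClass y → IsRationalClass (t y)) ∧
    (∀ (i j : ℕ) (y : complexBetti S (2 * 1)),
      IsOfHodgeType 2 S (2 * 1) i j y → IsOfHodgeType 2 S (2 * 1) i j (t y)) ∧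
    (∀ d ∈ algebraicClasses S 1, t d = 0) ∧
    (∀ (y : complexBetti S (2 * 1)), ∀ d ∈ algebraicClasses S 1,
      cupProduct (rfl : 2 * 1 + 2 * 1 = 2 * 2) (t y) d = 0) ∧
    Irreducible P ∧ P.natDegree = 2 ∧ IsAnnihilatedOnTranscendentalBy S t P ∧
    TranscendentalEndomorphismsGeneratedBy S t)

/-- `NLAscentFamily₂[S, hS]`: **the displayed Noether–Lefschetz ascent family through `S ⊗ S`, quadratic
form** — as `NLAscentFamily` of `…NLAscent`, except that the residual fibres are squares `S' ⊗ S'` of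
K3 surfaces `S'` with `Quadratic[S']` and `ρ(S') + 2 = ρ(S)` (memo NL-ASCENT r2 §2 and §4: it EXISTS for
every K3 surface with real multiplication by a real quadratic field and `ρ(S) ≥ 4` — the universal
family over the `E`-eigenperiod component of `T(S)_ℚ ⊕ N₀`, `N₀ ⊂ h^⊥` a binary `E`-trace form; not
constructed in the tree). Local notation only. [cite: GeemenSchutt2023, §2.6, Prop. 3.2 and §6.6]
[cite: VoisinHodgeII2003, §5.3.4 and §7.3.2] -/
local notation3 (prettyPrint := false) "NLAscentFamily₂[" S ", " hS "]" =>
  (∃ (t f : complexBetti S (2 * 1) →ₗ[ℂ] complexBetti S (2 * 1)),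
    (∀ y, IsRationalClass y → IsRationalClass (t y)) ∧
    (∀ d ∈ algebraicClasses S 1, t d = 0) ∧
    TranscendentalEndomorphismsGeneratedBy S t ∧
    (∀ y, f y ∈ algebraicClasses S 1) ∧
    (∀ y : complexBetti S (2 * 1),
      (∀ d ∈ algebraicClasses S 1, cupProduct (rfl : 2 * 1 + 2 * 1 = 2 * 2) y d = 0) → f y = 0) ∧
    ∃ (𝒳 B : SchemeOver ℂ) (g : 𝒳 ⟶ B),
      IsSmoothProjectiveFamily g 4 ∧ IsQuasiProjectiveOver 𝒳 ∧ IsQuasiProjectiveOver B ∧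
      AlgebraicGeometry.Smooth B.hom ∧ IrreducibleSpace B.left ∧
      ∃ (σ : ComplexPoints B → FiberClass g (2 * 2)) (hpt : ∀ b, (σ b).pt = b), Continuous σ ∧
      ∃ (b₁ : ComplexPoints B) (e₁ : S ⊗ S ≅ fiberOver g b₁),
        (∀ y : complexBetti S (2 * 1),
          t y + f y = Corr[complexOrientationFamily, hS ;
            complexBetti.map e₁.hom (2 * 2) ((σ b₁).clsAt (hpt b₁)), y]) ∧
        ∀ᶠ b in residual (ComplexPoints B),
          IsRationalClass ((σ b).clsAt (hpt b)) ∧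
          IsOfHodgeType 4 (fiberOver g b) (2 * 2) 2 2 ((σ b).clsAt (hpt b)) ∧
          ∃ (S' : SchemeOver ℂ) (_ : IsK3Surface S') (_ : fiberOver g b ≅ S' ⊗ S'),
            Quadratic[S'] ∧
            Module.finrank ℂ ↥(algebraicClasses S' 1) + 2 = Module.finrank ℂ ↥(algebraicClasses S 1))

/-- **HC⁴ for every quadratic-RM K3 square with `ρ(S) ≥ 2`, from Buskin, markings, the displayed
quadratic ascent families at `ρ ≥ 4`, and HC⁴ for the non-CM quadratic-RM K3 squares at `ρ = 2`** —
strong induction on the Picard number in steps of two: CM (imaginary quadratic `E`) by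
`CMThird.hodgeConjectureFor_square_of_CM_of_buskin`; `ρ = 2` by `hCell`; `ρ = 3` is not a
real-multiplication rank (`19` prime: `hodgeConjectureFor_square_of_forall_mul_add_ne`); at `ρ ≥ 4` the
residual fibres of the ascent family are quadratic-RM K3 squares of Picard number `ρ − 2 ≥ 2`, where the
induction hypothesis gives HC⁴, so `NSAbsorption.hodgeConjectureFor_square_of_residual_hodgeConjectureFor_of_section`
concludes. [cite: GeemenSchutt2023, §2.6, Prop. 3.2 and §6.6] [cite: VoisinHodgeII2003, §7.3.2]
[cite: Buskin2019, Thm. 1.1] [cite: Varesco2023, §2 (p. 8)] -/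
theorem hodgeConjectureFor_square_of_quadratic_nlAscent (hB : Buskin2019_hodgeIsometry_algebraic)
    (hmark : Huybrechts_K3_marking_exists)
    (hAsc : ∀ (S : SchemeOver ℂ) (hS : IsK3Surface S), ¬ HasComplexMultiplication S → Quadratic[S] →
      4 ≤ Module.finrank ℂ ↥(algebraicClasses S 1) → NLAscentFamily₂[S, hS.isSmoothProjective])
    (hCell : ∀ (S : SchemeOver ℂ) (hS : IsK3Surface S), ¬ HasComplexMultiplication S → Quadratic[S] →
      Module.finrank ℂ ↥(algebraicClasses S 1) = 2 → HodgeConjectureFor 4 (S ⊗ S))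
    (k : ℕ) : ∀ (S : SchemeOver ℂ) (hS : IsK3Surface S), Quadratic[S] →
      Module.finrank ℂ ↥(algebraicClasses S 1) = k → 2 ≤ k → HodgeConjectureFor 4 (S ⊗ S) := by
  induction k using Nat.strong_induction_on with
  | _ k ih =>
  intro S hS hQ hk h2
  by_cases hCM : HasComplexMultiplication S
  · exact CMThird.hodgeConjectureFor_square_of_CM_of_buskin hB hmark S hS hCM
  by_cases hk2 : k = 2
  · exact hCell S hS hCM hQ (hk.trans hk2)
  by_cases hk3 : k = 3
  · refine hodgeConjectureFor_square_of_forall_mul_add_ne hB hmark hS fun e m he hm => ?_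
    rw [hk, hk3]
    exact mul_add_ne_of_lt_six_or_prime he hm (Or.inr (by norm_num)) (by norm_num)
  have h4 : 4 ≤ Module.finrank ℂ ↥(algebraicClasses S 1) := by omega
  obtain ⟨t, f, ht_rat, ht_N, hgen, hfN, hfT, 𝒳, B, g, hg, h𝒳, hBq, hBsm, hirr, σ, hpt, hσ, b₁, e₁,
    hind, hres⟩ := hAsc S hS hCM hQ h4
  haveI := hirr
  refine NSAbsorption.hodgeConjectureFor_square_of_residual_hodgeConjectureFor_of_section
    hS.isSmoothProjective t ht_rat ht_N hgen f hfN hfT g hg h𝒳 hBq hBsm σ hσ hpt ?_ ?_ ?_ b₁ e₁ hind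
  · filter_upwards [hres] with b hb
    obtain ⟨-, -, S', hS', e', hQ', hρ'⟩ := hb
    have hlt : Module.finrank ℂ ↥(algebraicClasses S' 1) < k := by omega
    have h2' : 2 ≤ Module.finrank ℂ ↥(algebraicClasses S' 1) := by omega
    exact (hodgeConjectureFor_iff_of_iso' e').2 (ih _ hlt S' hS' hQ' rfl h2')
  · filter_upwards [hres] with b hb
    exact hb.1
  · filter_upwards [hres] with b hb
    exact hb.2.1

/-- **The real-quadratic part of the crux, governed by Picard number 2.** For every projective K3
surface `S` with `Quadratic[S]` and `ρ(S) ≥ 3` (the range of `PicardThreeK3Squares`),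
`HodgeConjectureFor 4 (S ⊗ S)` follows from Buskin, markings, the displayed quadratic ascent families
(moduli input (I1′), unconditional for real quadratic fields by memo NL-ASCENT r2 §4) and HC⁴ for the
non-CM quadratic-RM K3 squares of Picard number `2` — the K3 form of crux #5's cell `(ρ(X), d) = (3, 2)`.
[cite: GeemenSchutt2023, §2.6, Prop. 3.2, §3.9 and §6.6] [cite: Buskin2019, Thm. 1.1] [cite: Varesco2023, §2 (p. 8)] -/
theorem hodgeConjectureFor_square_of_quadratic_nlAscent_of_three_le
    (hB : Buskin2019_hodgeIsometry_algebraic) (hmark : Huybrechts_K3_marking_exists)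
    (hAsc : ∀ (S : SchemeOver ℂ) (hS : IsK3Surface S), ¬ HasComplexMultiplication S → Quadratic[S] →
      4 ≤ Module.finrank ℂ ↥(algebraicClasses S 1) → NLAscentFamily₂[S, hS.isSmoothProjective])
    (hCell : ∀ (S : SchemeOver ℂ) (hS : IsK3Surface S), ¬ HasComplexMultiplication S → Quadratic[S] →
      Module.finrank ℂ ↥(algebraicClasses S 1) = 2 → HodgeConjectureFor 4 (S ⊗ S))
    (hS : IsK3Surface S) (hQ : Quadratic[S]) (h3 : 3 ≤ Module.finrank ℂ ↥(algebraicClasses S 1)) :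
    HodgeConjectureFor 4 (S ⊗ S) :=
  hodgeConjectureFor_square_of_quadratic_nlAscent hB hmark hAsc hCell _ S hS hQ rfl (by omega)

end Summit.HodgeConjecture.HodgeConjecture.Theorems.MarkmanPartnerTransport.NLAscent

end
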